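import Summits.QuantumFields.BalabanUV.Beta.FP.TorusCompositeObjects
import Literature.MathematicalPhysics.QuantumFieldTheory.Balaban1983to89.Beta.AveragingContoursRooted

/-!
# `BalabanUV.Beta.FP.TowerRootCentred` — row D1 ∕ (C1), the row OWNER's SPEC ADDENDUM S-an2-g51-1 §2∕§5 item **F6f «ROOT MATCHING»**
# (journal [AN2-G51-SPEC-1]): the centred per-level roots of the comb tower compose to the centred root of the big block
# ([folklore] integer arithmetic over OUR bookkeeping objects; road «FP», D1 formalisation swarm LEAF PROVER 05)

WHAT.  leaf-06's `TorusCompositeObjects.bigRoot Lc rs n` is the big-comb root offset of the `n+1`-level tower assembled from the per-level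
in-block roots `rs k ∈ box (d+1) Lc` by `bigRoot rs (n+1) = bigRatio n • toSite (rs 0) + bigRoot (rs ∘ succ) n` (`bigRatio Lc n = Lc^(n+1)`).
The (C1) matching of SPEC ADDENDUM S-an2-g51-1 §2 reads the composite chart `A_N = Ψ̂_m ∘ coDressKBmAt ρ (Lc^m) (KInv (Lc^m)) ∘ Ψ̂_mᵀ`
(`CompositeOneShotChart`, `ρ = bigRoot Lc rs …`) against the one-shot chart rooted at the CENTRE `ctr (d+1) (Lc^m)` of the big block; the two
conjugate the SAME `G^{bm}_{Lc^m}` exactly when the roots agree.  THIS FILE: for ODD `Lc` and the centred root `ctrOff (d+1) Lc` AT EVERY LEVEL,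
  `bigRoot Lc rs n = ctr (d+1) (bigRatio Lc n) = ctr (d+1) (Lc^(n+1))`
— coordinatewise `((Lc−1)∕2)·(1 + Lc + ⋯ + Lc^n) = (Lc^(n+1) − 1)∕2`, proved by the one-step identity `b·((a−1)∕2) + (b−1)∕2 = (b·a − 1)∕2` for odd
`a`, `b` (`Nat` division is exact there) and leaf-06's recursion.  Stated both for a root sequence `rs` with `hrs : ∀ k, rs k = ctrOff (d+1) Lc`
(rewrites under the consumers' binders) and for the literal constant sequence; `bigRatio` and `Lc ^ (n+1)` spellings.

HONEST DEPENDENCY (page 1, mandatory): continuum YM on T⁴ ⇐ BetaPertH ∧ nine spine estimates (0/9 proved); BetaPertH ⇐ (D1) ∧ (D4) ∧ CAP+tail;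
G-an2-4 gates asym, D1 and NE2/3/4.  HONEST FRAMING (cell contract, verbatim): «discharging `BetaPertH` makes Bałaban's UV stability UNCONDITIONAL —
a real constructive-QFT result; it is NOT the continuum limit and NOT the Clay problem.»  ABSOLUTE RULE (cell charter, verbatim): «No internally-minted
statement may enter as a cited fact. Every hypothesis is either kernel-proved in this package or a verbatim quotation of a PUBLISHED theorem with page
reference. The manuscript(s) under audit are NOT citable for their own disputed steps — they are the thing under adjudication; programme-internal
(2001/route/tribunal) claims are never citable.»  [folklore] integer arithmetic only; no `def`, no `def … : Prop`, nothing cited, 0 sorry; 0 estimates;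
0∕4 row-D1 binders (hW, hR, D1Tel, D1Rep); NOT (C1), NOT (T-ID), NOT SDF, NOT D1, NOT BetaPertH, NOT continuum, NOT Clay.  No existing file touched.
D1 formalisation swarm LEAF PROVER 05 (b2b-balaban-beta-d1-formalise-leaf-05 gen 39), 2026-08-23.
-/

namespace Summit.QuantumFields.BalabanUV.Beta.FP.TowerRootCentred

open Literature.MathematicalPhysics.QuantumFieldTheory.Balaban1983to89.Beta
open AffineAveraging (Site toSite)
open AveragingContoursRooted (ctrOff ctr ctr_apply)
open Summit.QuantumFields.BalabanUV.Beta.FP.TorusCompositeObjects (bigRatio bigRoot bigRatio_zero bigRatio_succ bigRatio_eq_pow bigRoot_zero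
  bigRoot_succ)

variable {d : ℕ}

/-! ## §1 The arithmetic of odd centres -/

/-- [folklore] For odd `a`, `b`: `b·((a−1)∕2) + (b−1)∕2 = (b·a − 1)∕2` (all three `Nat` divisions are exact), in the integer form in which the
root offsets are read. -/
theorem mul_half_pred_add_half_pred {a b : ℕ} (ha : Odd a) (hb : Odd b) :
    (b : ℤ) * (((a - 1) / 2 : ℕ) : ℤ) + (((b - 1) / 2 : ℕ) : ℤ) = (((b * a - 1) / 2 : ℕ) : ℤ) := by
  obtain ⟨i, rfl⟩ := ha
  obtain ⟨j, rfl⟩ := hb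
  have h1 : (2 * i + 1 - 1) / 2 = i := by omega
  have h2 : (2 * j + 1 - 1) / 2 = j := by omega
  have h3 : ((2 * j + 1) * (2 * i + 1) - 1) / 2 = 2 * i * j + i + j := by
    have : (2 * j + 1) * (2 * i + 1) - 1 = 2 * (2 * i * j + i + j) := by ring_nf; omega
    rw [this]; omega
  rw [h1, h2, h3]
  push_cast
  ring

/-- [folklore] The big-comb ratio of an odd `Lc` is odd: `bigRatio Lc n = Lc^(n+1)`. -/
theorem odd_bigRatio {Lc : ℕ} (hLc : Odd Lc) (n : ℕ) : Odd (bigRatio Lc n) := by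
  rw [bigRatio_eq_pow]; exact hLc.pow

/-- [folklore] The centred offset coordinate, cast to `ℤ`. -/
theorem toSite_ctrOff_apply (L : ℕ) (i : Fin d) : toSite (ctrOff d L) i = (((L - 1) / 2 : ℕ) : ℤ) := rfl

/-! ## §2 F6f — the centred per-level roots compose to the centred root of the big block -/

/-- [folklore] **F6f «ROOT MATCHING» (SPEC ADDENDUM S-an2-g51-1 §2), `bigRatio` spelling, root SEQUENCE form**: for odd `Lc` and a per-level root
sequence that is the centred offset at every level, the big root offset of the `n+1`-level tower is the centred offset of the big block:
`bigRoot Lc rs n = ctr (d+1) (bigRatio Lc n)`. -/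
theorem bigRoot_eq_ctr_of_ctrOff {Lc : ℕ} (hLc : Odd Lc) :
    ∀ (n : ℕ) (rs : ℕ → (Fin (d + 1) → ℕ)), (∀ k, rs k = ctrOff (d + 1) Lc) → bigRoot Lc rs n = ctr (d + 1) (bigRatio Lc n)
  | 0, rs, hrs => by rw [bigRoot_zero, hrs 0, bigRatio_zero]; rfl
  | n + 1, rs, hrs => by
    rw [bigRoot_succ, hrs 0, bigRoot_eq_ctr_of_ctrOff hLc n (fun k => rs (k + 1)) (fun k => hrs (k + 1)), bigRatio_succ]
    funext i
    simp only [Pi.add_apply, Pi.smul_apply, smul_eq_mul, ctr, toSite_ctrOff_apply]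
    exact mul_half_pred_add_half_pred hLc (odd_bigRatio hLc n)

/-- [folklore] **F6f, `bigRatio` spelling, LITERAL constant-sequence form**: `bigRoot Lc (fun _ => ctrOff (d+1) Lc) n = ctr (d+1) (bigRatio Lc n)`. -/
theorem bigRoot_ctrOff {Lc : ℕ} (hLc : Odd Lc) (n : ℕ) :
    bigRoot Lc (fun _ => ctrOff (d + 1) Lc) n = ctr (d + 1) (bigRatio Lc n) :=
  bigRoot_eq_ctr_of_ctrOff hLc n _ fun _ => rfl

/-- [folklore] **F6f, power spelling, root SEQUENCE form**: `bigRoot Lc rs n = ctr (d+1) (Lc ^ (n+1))` — the root at which `CompositeOneShotChart`'s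
`coDressKBmAt (bigRoot Lc rs m) (Lc ^ (m+1)) (KInv …)` is read, identified with the one-shot centred root of the big block `Lc ^ (m+1)`. -/
theorem bigRoot_eq_ctr_pow_of_ctrOff {Lc : ℕ} (hLc : Odd Lc) (n : ℕ) (rs : ℕ → (Fin (d + 1) → ℕ))
    (hrs : ∀ k, rs k = ctrOff (d + 1) Lc) : bigRoot Lc rs n = ctr (d + 1) (Lc ^ (n + 1)) := by
  rw [bigRoot_eq_ctr_of_ctrOff hLc n rs hrs, bigRatio_eq_pow]

/-- [folklore] **F6f, power spelling, LITERAL constant-sequence form**: `bigRoot Lc (fun _ => ctrOff (d+1) Lc) n = ctr (d+1) (Lc ^ (n+1))`. -/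
theorem bigRoot_ctrOff_pow {Lc : ℕ} (hLc : Odd Lc) (n : ℕ) :
    bigRoot Lc (fun _ => ctrOff (d + 1) Lc) n = ctr (d + 1) (Lc ^ (n + 1)) :=
  bigRoot_eq_ctr_pow_of_ctrOff hLc n _ fun _ => rfl

/-- [folklore] the same with the right-hand side as a `toSite` of the big block's centred OFFSET (the `∃ s ∈ box, toSite s = bigRoot …` witness of
`CompositeOneShotChart.exists_box_toSite_eq_bigRoot`, made explicit): `bigRoot Lc rs n = toSite (ctrOff (d+1) (Lc ^ (n+1)))`. -/
theorem bigRoot_eq_toSite_ctrOff_pow {Lc : ℕ} (hLc : Odd Lc) (n : ℕ) (rs : ℕ → (Fin (d + 1) → ℕ))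
    (hrs : ∀ k, rs k = ctrOff (d + 1) Lc) : bigRoot Lc rs n = toSite (ctrOff (d + 1) (Lc ^ (n + 1))) :=
  bigRoot_eq_ctr_pow_of_ctrOff hLc n rs hrs

/-- [folklore] coordinatewise value: every coordinate of the big root is `(Lc^(n+1) − 1)∕2`. -/
theorem bigRoot_ctrOff_apply {Lc : ℕ} (hLc : Odd Lc) (n : ℕ) (i : Fin (d + 1)) :
    bigRoot Lc (fun _ => ctrOff (d + 1) Lc) n i = (((Lc ^ (n + 1) - 1) / 2 : ℕ) : ℤ) := by
  rw [bigRoot_ctrOff_pow hLc n, ctr_apply]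

/-- [folklore] kernel example (`decide`-free, by the theorem): `Lc = 3`, two levels (`n = 1`), `d+1 = 4`: the big root is `ctr 4 9 = (4,4,4,4)`
(`3·1 + 1 = 4 = (9−1)∕2`). -/
example : bigRoot 3 (fun _ => ctrOff 4 3) 1 = ctr 4 9 := by
  rw [bigRoot_ctrOff_pow (by decide : Odd 3) 1]; norm_num

end Summit.QuantumFields.BalabanUV.Beta.FP.TowerRootCentred
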